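import Summits.QuantumFields.YangMills.Theorems.BalabanLadderNTPointwiseFloor
import Summits.QuantumFields.YangMills.Theorems.LangevinControlUVOSLegsFromFemtoAndGapStubLowerBump
import Summits.QuantumFields.YangMills.Theses.BalabanLadder
import HarnessLib

/-!
# Crux `NT` (stmt-QuantumFields-19353), line «n32-variance» — Defs module: Bałaban's N32 in NT letters (`N32T`) and its
# three-point companion (`K3T`) BY NAME

Landing kit for the crux-plan line `Cruxes/NT/Lines/n32_variance.lean` (seat `ymfull-r2a-plan-1`, director-ym R590-ym item (12),
crux-written 2026-08-30T19:32:53Z; LADDER-YM rung R2a, node N32).  Critic idea-crit-9 g10 verdict #100 = PASS-WITH-PRICE (XL ∕ L+), statements unchanged.  This file = the line's §0 CHARACTER FOR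
CHARACTER (statements; one docstring sentence corrected per #100), in the fresh
namespace `…Cruxes.NT.N32Floors` (≠ the line file's `…Cruxes.NT.N32Variance`, so no FQN clash with the workfile):

* `UniformTwoPointFloor G r a` — the ℓ-UNIFORM (all-volume) pointwise two-point floor `ν·a(β)⁸ ≤ Cov_{T,β,L}(A_x, A_y)` on the
  physical window `a(β)‖y−x‖ ∈ [s₀, s₁]`, every torus `2L+1` with `Λ₅ ≤ a(β)L`, all `β ≥ β₅`;
* `UniformThreePointFloor G r a` — the signed volume-uniform three-point floor `ν₃·a(β)¹² ≤ sgn·κ₃,T(x,y,z)` on a cloud of three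
  disjoint physical balls;
* `N32T` — ∃ calibrated `(r, a)` carrying `UniformTwoPointFloor` (THE named stub statement: Bałaban's announced, unprinted N32
  [Balaban1989LargeFieldII p. 356] read for the action density);
* `K3T` — in any units carrying the N32T floor, `UniformThreePointFloor`.

The sorry-free glue of the line (§2–§5: `NT_of : N32T → K3T → BalabanLadder.NT`) lands next to this file
(`Theorems/BalabanLadderNTN32Variance.lean`).  With both in the tree the line's two stubs can be worked, landed and consumed BY NAME.

HONEST LABEL: four DEFINITIONS (open Props, VERBATIM from the crux-plan line); nothing here proves a floor, the crux NT, a rung, the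
leaf or any summit; finite-volume ∕ conditional vocabulary; not AF, not OS data, not the gap — the Yang–Mills mass gap is NOT proved.
Prover seat `ymfull-r2a-prover-2` g0 (R590-ym item (14)), 2026-08-30.
-/

set_option autoImplicit false

noncomputable section

open scoped SchwartzMap
open MeasureTheory Filter Topology Metric
open Literature.MathematicalPhysics.QuantumFieldTheory Literature.MathematicalPhysics.QuantumLattice
open Literature.Probability.LatticeModels
open Summit.QuantumFields.YangMills.Cruxes.OSLegsFromFemtoAndGap.DlrCollarTransfer

namespace Summit.QuantumFields.YangMills.Cruxes.NT.N32Floors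

/-! ## §0 The named statements (line `Lines/n32_variance.lean` §0, verbatim) -/

section Defs

variable (G : Type) [Group G] [TopologicalSpace G] [IsTopologicalGroup G] [CompactSpace G]
  [MeasurableSpace G] [BorelSpace G] (r : LatticeRep G) (a : ℝ → ℝ)

/-- **N32 in NT letters, per `(G, r, a)` — the ℓ-UNIFORM (all-volume) two-point floor of the action density at physical
separation.**  `∃ ν > 0`, a window `0 < s₀ < s₁`, thresholds `β₅, Λ₅`: for all `β ≥ β₅`, on EVERY torus `2L+1` with
`Λ₅ ≤ a(β)·L`, every pair of sites `x, y ∈ box L` at physical separation `a(β)‖y − x‖ ∈ [s₀, s₁]` has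
`ν · a(β)⁸ ≤ Cov_{T,β,L}(A_x, A_y)` (`A_x = dens x`, the plaquette rosette at `x`).  Bałaban's N32b/N32′ (order-`g⁴`
variance / separated two-point floor of one unit-scale variable, uniform in the volume) read for the dimension-4 density:
`a⁴A_x`, `a⁴A_y` at unit-order physical separation have covariance `≥ ν`.
(Source of the reading: Bałaban, Large Field Renormalization II (1989), p. 356 — averaged loop variables; the deferred «loop variables»
analysis, announced, not printed.  A route-posited OPEN statement, not a literature fact.) -/
def UniformTwoPointFloor : Prop :=
  ∃ ν s₀ s₁ β₅ Λ₅ : ℝ, 0 < ν ∧ 0 < s₀ ∧ s₀ < s₁ ∧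
    ∀ β : ℝ, β₅ ≤ β → ∀ L : ℕ, Λ₅ ≤ a β * L → ∀ x ∈ box 4 L, ∀ y ∈ box 4 L,
      s₀ ≤ a β * ‖siteToE (y - x)‖ → a β * ‖siteToE (y - x)‖ ≤ s₁ →
        ν * a β ^ 8 ≤ torusE G r β L (fun U => dens G r x U * dens G r y U) -
          torusE G r β L (dens G r x) * torusE G r β L (dens G r y)

/-- **The signed three-point floor on a cloud, per `(G, r, a)`** (volume-uniform).  Three closed balls of radius `ρ > 0`
around `p₁, p₂, p₃` at pairwise centre distance `> 2ρ`, a sign `sgn = ±1`, `ν₃ > 0`, thresholds `β₅, Λ₅`: for all `β ≥ β₅`,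
on every torus with `Λ₅ ≤ a(β)·L`, every lattice triple `x, y, z ∈ box L` with `a(β)x ∈ B̄(p₁,ρ)`, `a(β)y ∈ B̄(p₂,ρ)`,
`a(β)z ∈ B̄(p₃,ρ)` has `ν₃ · a(β)¹² ≤ sgn · κ₃,T(x, y, z)` (`torusK3`, the third cumulant of the rosettes).  (Route-posited OPEN statement.) -/
def UniformThreePointFloor : Prop :=
  ∃ (p₁ p₂ p₃ : EuclideanSpace ℝ (Fin 4)) (ρ ν₃ sgn β₅ Λ₅ : ℝ), 0 < ρ ∧
    2 * ρ < dist p₁ p₂ ∧ 2 * ρ < dist p₂ p₃ ∧ 2 * ρ < dist p₁ p₃ ∧ 0 < ν₃ ∧ (sgn = 1 ∨ sgn = -1) ∧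
    ∀ β : ℝ, β₅ ≤ β → ∀ L : ℕ, Λ₅ ≤ a β * L → ∀ x ∈ box 4 L, ∀ y ∈ box 4 L, ∀ z ∈ box 4 L,
      a β • siteToE x ∈ closedBall p₁ ρ → a β • siteToE y ∈ closedBall p₂ ρ → a β • siteToE z ∈ closedBall p₃ ρ →
        ν₃ * a β ^ 12 ≤ sgn * torusK3 G r β L x y z

end Defs

/-- **`N32T` — Bałaban's N32 in NT letters (THE named stub statement).**  For every compact simple `G` there are a lattice
representation `r` and a unit map `a > 0`, `a → 0` carrying the volume-uniform two-point floor `UniformTwoPointFloor G r a`.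
This is what FIXES the units: the floor fails if `a(β)ξ(β) → 0` (window beyond the correlation length) and if
`a(β)ξ(β) → ∞` (window in the deep UV, where `n⁸ Cov → 0` logarithmically), so it pins `a ≍ ξ⁻¹` — dimensional transmutation,
invisible to fixed-order lattice perturbation theory (`n⁸ Cov_T = O(β⁻²)` at fixed `n`).  (Docstring: the two parentheses of this
sentence are swapped relative to the line file, as priced by idea-crit-9 verdict #100; the STATEMENT is verbatim.)
(Source of the reading: Bałaban, Large Field Renormalization II (1989), p. 356 — averaged loop variables; the deferred «loop variables»
analysis, announced, not printed.  A route-posited OPEN statement, not a literature fact.) -/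
def N32T : Prop :=
  ∀ (G : Type) [Group G] [TopologicalSpace G] [IsTopologicalGroup G] [CompactSpace G],
    IsCompactSimpleLieGroup G → letI : MeasurableSpace G := borel G; haveI : BorelSpace G := ⟨rfl⟩;
    ∃ (r : LatticeRep G) (a : ℝ → ℝ), (∀ β, 0 < a β) ∧ Tendsto a atTop (𝓝 0) ∧ UniformTwoPointFloor G r a

/-- **`K3T` — the three-point companion of N32 (clause (ii) of `NT` is not Bałaban's).**  In ANY units `(r, a)` carrying the
N32T floor (`a > 0`, `a → 0`, `UniformTwoPointFloor G r a` — so `a ≍ ξ⁻¹` is already pinned), the rosettes have a signed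
volume-uniform three-point floor on some cloud of three disjoint physical balls (`UniformThreePointFloor G r a`); expected
from the one-loop (or two-loop) sign of `⟨tr F²(x) tr F²(y) tr F²(z)⟩_conn` on a small (UV) triangle, where the pinned units make the
running coupling small.  (Route-posited OPEN statement.) -/
def K3T : Prop :=
  ∀ (G : Type) [Group G] [TopologicalSpace G] [IsTopologicalGroup G] [CompactSpace G],
    IsCompactSimpleLieGroup G → letI : MeasurableSpace G := borel G; haveI : BorelSpace G := ⟨rfl⟩;
    ∀ (r : LatticeRep G) (a : ℝ → ℝ), (∀ β, 0 < a β) → Tendsto a atTop (𝓝 0) →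
      UniformTwoPointFloor G r a → UniformThreePointFloor G r a

end Summit.QuantumFields.YangMills.Cruxes.NT.N32Floors

end
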